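/-
Origin: expansion seat `prover-pub-hodgecm-mc-binder-1-g15-0`, handover #R99 2026-08-20T18:48:17Z md5 b76cadf3bd2a (141 l.; NEW additive universe-free datum-generic (p = 2) leaf; imports #R95 Model/LevelCoverAlgebraic + #R98 Model/HeckeLevelCongruence + Vendored ShimuraVarieties/UnitaryBallLevelFiniteCover + Vendored Automorphic/PicardCMPrerequisites; install after #R95 and #R98; drops with #R95 or #R98; NAME LIST: HodgeCM.Model.HeckeAdmissible.isCoveringMap_levelProj_of_levelModel · HodgeCM.Model.HeckeAdmissible.finiteIndex_heckeLevel · HodgeCM.Model.HeckeAdmissible.exists_levelModel_heckeLevel · HodgeCM.Model.HeckeAdmissible.isHeckeAdmissible) (`HOME/mc/pub-hodgecm-mc-binder-1-g15/stage59/HodgeCM/Model/HeckeAdmissible.lean`, md5 b76cadf3bd2a, 141 lines);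
landed by the gen-24 packager (p-g24) in gate run 59 as `HodgeCM/Model/HeckeAdmissible.lean` (verbatim).
-/
/-
Copyright (c) 2026 the pub-hodgecm formalisation cell (harness21).  New file, not vendored.
Origin: session prover-pub-hodgecm-mc-binder-1-g15-0 (unit pub-hodgecm-mc-binder-1-g15, BINDER PROVER gen 15 of lineage mc-binder-1;
content lane (J-Liu-Θ), scope memo `HOME/mc/pub-hodgecm-mc-binder-1-g14/JLIU-THETA-SCOPE.md` §6.2 (J1)(b), HECKE-TOWER sub-leaf (T6b):
«every rational `g` is admissible for the vendored Hecke correspondence — IN THE PACKAGE, over the cited record (ii-a)»), 2026-08-20.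
Intended final place: `HodgeCM/Model/HeckeAdmissible.lean` (NEW additive leaf, universe-free, datum-generic (p = 2); imports ONLY this lane's
`HodgeCM.Model.LevelCoverAlgebraic` (#R95) and `HodgeCM.Model.HeckeLevelCongruence` (#R98) and the vendored twins
`…ShimuraVarieties.UnitaryBallLevelFiniteCover`, `…Automorphic.PicardCMPrerequisites`; nothing imports it; drops with #R95 or #R98).
-/
import Summits.HodgeConjecture.HodgeCM.Model.LevelCoverAlgebraic
import Summits.HodgeConjecture.HodgeCM.Model.HeckeLevelCongruence
import Literature.AlgebraicGeometry.ShimuraVarieties.UnitaryBallLevelFiniteCover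
import Literature.NumberTheory.Automorphic.PicardCMPrerequisites

set_option autoImplicit false

/-!
# Every `g ∈ U(V)(F)` is admissible for the Hecke correspondence of a compact ball quotient surface — in the package

The vendored Hecke file (`ShimuraVarieties/HeckeCorrespondenceAction`) defines `T_g` for `g` ADMISSIBLE (`D.IsHeckeAdmissible g`: `g ∈ U(V)(F)`,
`[Γ : N_g] < ∞`, and `N_g\𝔹 → X(ℂ)` a covering map) and proves admissibility only for `g ∈ Γ`; in the hub tree admissibility of every rational `g` is a
Summits-side theorem (`…OrthogonalEnveloped.HeckeGraphChow.isHeckeAdmissible_of_mem_unitaryGroup`), not vendorable under the package's `Literature/**`-only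
convention (scope memo §6.2 (b), «2nd root»).  This leaf proves it INSIDE the package for surfaces (`p = 2`), from:

* `HeckeLevelCongruence` (#R98): `[Γ : N_g] < ∞` and `N_g` is a torsion-free CONGRUENCE subgroup (adelic levels; Shimura 1971 §3.1/§3.3);
* `LevelCoverAlgebraic.levelHomeo` (#R95): any ball uniformization `DN` of a smooth projective `XN` by the same hermitian space with group `N` identifies
  `XN(ℂ) ≃ₜ N\𝔹` over `X(ℂ)`, so that `levelProj N` is — up to this homeomorphism — a map intertwining two uniformizations, hence a covering map by the
  vendored `isCoveringMap_of_unif_comp` route (`isLocalHomeomorph_of_unif_comp` + Mathlib `isLocalHomeomorph_iff_isCoveringMap` on the compact Hausdorff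
  `N\𝔹`) — `isCoveringMap_levelProj_of_levelModel`;
* the cited record (ii-a) `PicardCM.BallQuotientUniformisedDatum` (= `BallQuotientUniformised` repackaged; Shafarevich IX §3.2 / Baily–Borel via
  Genestier–Ngô Thm 4.5.2 / Chow), which SUPPLIES such an `(XN, DN)` for the torsion-free congruence subgroup `N_g` — `exists_levelModel_heckeLevel`.

Main results: `isHeckeAdmissible_of_levelModel` (from a given model of the Hecke level cover) and
**`isHeckeAdmissible (hU : BallQuotientUniformisedDatum) (D : UnitaryBallQuotientDatum 2 X) (hg : g ∈ U(V)(F)) : D.IsHeckeAdmissible g`**.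
KIND: kernel theorems; the only record is the cell's standing (ii-a); nothing cited anew, nothing minted; 0 proof holes; expected `#print axioms` ⊆
{propext, Classical.choice, Quot.sound}.

References: G. Shimura (1971), §3.1 Prop. 3.1, §3.3, §7.2; N. Bergeron, J. Millson, C. Moeglin, Acta Math. 216 (2016), Introduction §1.1, Part 2 §1.3;
A. Borel, *Introduction aux groupes arithmétiques* (1969), Prop. 7.13 (proper discontinuity); A. Hatcher (2002), §1.3.
-/

noncomputable section

open MulAction Function Set
open CategoryTheory
open Literature.AlgebraicGeometry.Motives (SchemeOver ComplexPoints AlgPoints IsSmoothProjective)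
open Literature.NumberTheory.Automorphic.PicardCM (BallQuotientUniformisedDatum)

namespace HodgeCM.Model.HeckeAdmissible

open Literature.AlgebraicGeometry.ShimuraVarieties UnitaryBallQuotientDatum
open HodgeCM.Model.LevelCoverAlgebraic HodgeCM.Model.HeckeLevelCongruence

variable {X XN : SchemeOver ℂ} (D : UnitaryBallQuotientDatum 2 X) (N : Subgroup ↥D.Γ)
  (DN : UnitaryBallUniformisationDatum 2 XN) (hH : DN.Hℂ = D.Hℂ)
  (hΓ : DN.Γ.map (Matrix.GeneralLinearGroup.map DN.τ₁) = (N.map D.Γ.subtype).map (Matrix.GeneralLinearGroup.map D.τ₁))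

/-! ### The level projection is a covering map, given an algebraic model of the level cover -/

include hH hΓ in
/-- **`N\𝔹 → X(ℂ)` is a covering map** whenever the level-`N` cover has a ball-uniformized smooth projective model `(XN, DN)` (same hermitian space,
group `N`): through `levelHomeo : N\𝔹 ≃ₜ XN(ℂ)` the projection intertwines `unif_N` and `unif`, so it is a local homeomorphism from a compact
Hausdorff space (vendored `isLocalHomeomorph_of_unif_comp`), i.e. a covering map. [cite: BergeronMillsonMoeglin2016Balls, Part 2 §1.3]
[cite: Borel1969, Prop. 7.13] -/
theorem isCoveringMap_levelProj_of_levelModel : IsCoveringMap (D.levelProj N) := by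
  set e := levelHomeo D N DN hH hΓ with he
  have hf : ∀ v ∈ DN.cone, (D.levelProj N ∘ e.symm) (DN.unif v) = D.toUnitaryBallUniformisationDatum.unif v := fun v hv ↦ by
    have hv' : v ∈ D.cone := by
      change v ∈ negCone D.Hℂ
      rw [← hH]
      exact hv
    have hsymm : e.symm (DN.unif v) = D.toLevel N (D.toBall ⟨v, hv'⟩) := by
      rw [Homeomorph.symm_apply_eq]
      exact (levelHomeo_toLevel_toBall D N DN hH hΓ ⟨v, hv'⟩).symm
    rw [Function.comp_apply, hsymm]
    rfl
  have hloc : IsLocalHomeomorph (D.levelProj N ∘ e.symm) :=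
    UnitaryBallUniformisationDatum.isLocalHomeomorph_of_unif_comp (D₁ := DN) (D₂ := D.toUnitaryBallUniformisationDatum) hH hf
  have hloc' : IsLocalHomeomorph (D.levelProj N) := by
    have hcomp : (D.levelProj N : D.LevelCover N → ComplexPoints X) = (D.levelProj N ∘ e.symm) ∘ e := by
      funext x
      simp only [Function.comp_apply, Homeomorph.symm_apply_apply]
    rw [hcomp]
    exact hloc.comp e.isLocalHomeomorph
  haveI := DN.compactSpace_complexPoints
  haveI := DN.t2Space_complexPoints
  haveI := D.toUnitaryBallUniformisationDatum.t2Space_complexPoints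
  haveI : CompactSpace (D.LevelCover N) := e.symm.compactSpace
  haveI : T2Space (D.LevelCover N) := e.symm.t2Space
  exact isLocalHomeomorph_iff_isCoveringMap.1 hloc'

/-! ### Admissibility -/

/-- The vendored Hecke stabiliser / level ARE the generic ones of `HeckeLevelCongruence` (same carriers). [folklore] -/
theorem heckeLevel_eq (g : GL (Fin 3) D.E) : D.heckeLevel g = heckeLevelOf D.Γ g := rfl

/-- **`[Γ : N_g] < ∞` for every `g ∈ U(V)(F)`** (the datum's `Γ` is a congruence subgroup). [cite: Shimura1973, §3.1 and §3.3] -/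
theorem finiteIndex_heckeLevel {g : GL (Fin 3) D.E} (hg : g ∈ unitaryGroup (conjRingHom D.E) D.H) : (D.heckeLevel g).FiniteIndex :=
  (isCongruenceSubgroup_heckeLevelOf_cm D.H D.isCongruenceSubgroup hg).2

/-- **`N_g` (read in `GL₃(E)`) is a congruence subgroup** for every `g ∈ U(V)(F)`. [cite: Shimura1973, §3.1] -/
theorem isCongruenceSubgroup_heckeLevel {g : GL (Fin 3) D.E} (hg : g ∈ unitaryGroup (conjRingHom D.E) D.H) :
    IsCongruenceSubgroup (conjRingHom D.E) D.H ((D.heckeLevel g).map D.Γ.subtype) :=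
  (isCongruenceSubgroup_heckeLevelOf_cm D.H D.isCongruenceSubgroup hg).1

/-- `N_g` (read in `GL₃(E)`) is torsion free (it lies in the torsion-free `Γ`). [folklore] -/
theorem torsionFree_heckeLevel (g : GL (Fin 3) D.E) :
    ∀ γ ∈ (D.heckeLevel g).map D.Γ.subtype, IsOfFinOrder γ → γ = 1 := by
  rintro _ ⟨γ, _, rfl⟩ hfin
  exact D.torsionFree _ γ.2 hfin

include hH hΓ in
/-- **Admissibility from an algebraic model of the Hecke level cover.** [cite: Shimura1973, §3.1 and §7.2] -/
theorem isHeckeAdmissible_of_levelModel' {g : GL (Fin 3) D.E} (hg : g ∈ unitaryGroup (conjRingHom D.E) D.H) (hN : N = D.heckeLevel g) :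
    D.IsHeckeAdmissible g where
  mem_unitaryGroup := hg
  finiteIndex := finiteIndex_heckeLevel D hg
  isCoveringMap := by
    subst hN
    exact isCoveringMap_levelProj_of_levelModel D _ DN hH hΓ

/-- **The cited record (ii-a) supplies an algebraic model of the Hecke level cover**: a smooth projective surface `XN` with a ball uniformization `DN`
by the SAME hermitian space and group `N_g` (`N_g` is a torsion-free congruence subgroup, `HeckeLevelCongruence`).
[cite: GenestierNgo2020, Theorem 4.5.2] [cite: Mumford1981, (4.6) Corollary, p. 61; (4.14) Corollary] -/
theorem exists_levelModel_heckeLevel (hU : BallQuotientUniformisedDatum) {g : GL (Fin 3) D.E} (hg : g ∈ unitaryGroup (conjRingHom D.E) D.H) :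
    ∃ (XN : SchemeOver ℂ) (DN : UnitaryBallUniformisationDatum 2 XN), DN.Hℂ = D.Hℂ ∧
      DN.Γ.map (Matrix.GeneralLinearGroup.map DN.τ₁) = ((D.heckeLevel g).map D.Γ.subtype).map (Matrix.GeneralLinearGroup.map D.τ₁) := by
  obtain ⟨XN, DN, hE, hHm, hΓm⟩ := hU D.E D.H ((D.heckeLevel g).map D.Γ.subtype) D.conj_H_apply D.anisotropic D.signature_τ₁ D.posDef_of_ne
    (isCongruenceSubgroup_heckeLevel D hg) (torsionFree_heckeLevel D g)
  exact ⟨XN, DN, hHm, hΓm⟩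

/-- **Every `g ∈ U(V)(F)` is admissible for the Hecke correspondence of a compact ball quotient SURFACE**, over the cited record (ii-a)
`BallQuotientUniformisedDatum`. [cite: Shimura1973, §3.1 and §7.2] [cite: GenestierNgo2020, Theorem 4.5.2] -/
theorem isHeckeAdmissible (hU : BallQuotientUniformisedDatum) {g : GL (Fin 3) D.E} (hg : g ∈ unitaryGroup (conjRingHom D.E) D.H) :
    D.IsHeckeAdmissible g := by
  obtain ⟨XN, DN, hH, hΓ⟩ := exists_levelModel_heckeLevel D hU hg
  exact isHeckeAdmissible_of_levelModel' D (D.heckeLevel g) DN hH hΓ hg rfl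

end HodgeCM.Model.HeckeAdmissible

end
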